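/-
Copyright (c) 2026 The decomp-a2c cell. All rights reserved.
Released under Apache 2.0 license as described in the file LICENSE.
-/
import Summits.AtomisticToContinuum.Crystallization.Theorems.ChartedZeroExcessLayeredLatticeLiouvilleWE

/-!
# ChartedZeroExcessLayeredLatticeLiouville — part WF «DivergenceEnergy»: the column-flux divergence of a harmonic field is small in mean square
  (decomp-a2c-lens-2, g58; helper of stmt-AtomisticToContinuum-26636, leaf (LD′) `ModalLipschitzZ`; brick (4a) `ModalLipschitzAt`, vertical half (4a⊥),
  step (SG) of memo NODE-g58c — term (A))

WE bounded `Σ_{X ∈ Xs} ‖DIV(X)‖²` (`DIV(X) = colFlux T ψ γ m − colFlux T ψ γ (m−1)`, `X = (γ, m)`) by `8F²·(5832·(P₁ + P₂) + #Xs·(216·G₂)²)` with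
`P_a = Σ_{R} ‖D₃D_aψ‖²` and `G₂` a sup of the in-plane second differences.  For `ψ` `ϱ`-truncated-harmonic on `idxBall x₀ n`, `n ≥ 64(ϱ/c + 2)`, and a
block `Xs ⊆ idxBall x₀ (n/8)` this part plugs in the ENERGY estimates of part WA:
* `P_a ≤ E_{n/2}(D_aψ) ≤ 256·(54F/κ₀)·E_n(ψ)/n²` — the mixed difference `D₃D_aψ` is a unit difference of the HARMONIC in-plane difference field `D_aψ`
  (VC `sum_norm_latDiff_sq_le` with the vertical step, WA `energy_iterate₁_le`; no Caccioppoli inequality is ever applied to the non-harmonic `D₃ψ`);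
* `G₂² = 6912·(54F/κ₀)·lipConst·E_n(ψ)/(n²·#idxBall x₀ n)` from WA `inPlane_hessian_core` on `idxBall x₀ (n/4) ⊇` the `3⌊ϱ/c⌋`-neighbourhood
  of the block;
* ★ `sum_colFluxDiv_sq_le_energy`: `n²·Σ_{X ∈ Xs} ‖DIV(X)‖² ≤ divConst c κ₀ · E_n(ψ)` with `divConst = 2603778048·F²·(54F/κ₀)·lipConst c κ₀` —
  uniformly in `ϱ`, in the block (as long as it lies in `idxBall x₀ (n/8)`) and in the layer set `T`.
-/

namespace Summit.AtomisticToContinuum.Crystallization.Theorems.ChartedZeroExcessLayeredLatticeLiouville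

open Summit.AtomisticToContinuum.Crystallization.Theorems.ChartedPlanarOrderRigidityDoor (E3)
open Finset
open scoped InnerProductSpace RealInnerProductSpace BigOperators

noncomputable section DivergenceEnergy

variable {c : ℝ} {a b : E3} {w : ℤ → E3}

/-! ### WF.1  Index-ball bookkeeping -/

-- `idxNorm_idxAxis₃_le : (idxNorm idxAxis₃ : ℝ) ≤ 1` removed at landing (hand-2 g27): the gate's dedup normaliser identifies its statement with
-- WA's `idxNorm_idxAxis₂_le` (dedup.landed); it is inlined at its uses (here and in WI) as a local `have`; all other statements untouched.

/-- an index ball of non-negative radius has a site. [formal bookkeeping] -/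
theorem ncard_idxBall_pos (x₀ : Cell 2 × ℤ) {n : ℝ} (hn : 0 ≤ n) : (0 : ℝ) < ((idxBall x₀ n).ncard : ℝ) := by
  rw [← coe_idxBallF, Set.ncard_coe_finset]
  exact_mod_cast Finset.card_pos.mpr ⟨x₀, mem_idxBallF.mpr (by rwa [dist_self])⟩

/-- a block inside a smaller index ball has at most `#idxBall x₀ n` sites. [formal bookkeeping] -/
theorem card_le_ncard_idxBall {Xs : Finset (Cell 2 × ℤ)} {x₀ : Cell 2 × ℤ} {m n : ℝ} (hXs : ∀ X ∈ Xs, X ∈ idxBall x₀ m) (hmn : m ≤ n) :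
    (#Xs : ℝ) ≤ ((idxBall x₀ n).ncard : ℝ) := by
  rw [← coe_idxBallF, Set.ncard_coe_finset]
  exact_mod_cast Finset.card_le_card fun X hX => mem_idxBallF.mpr ((hXs X hX : dist X x₀ ≤ m).trans hmn)

/-- the sites of the coordinate box of half-width `3r` about a site `X ∈ idxBall x₀ s`, in the layer of `X`, lie in `idxBall x₀ n'` once `s + k ≤ n'` and
`3r ≤ k`. [formal bookkeeping] -/
theorem mem_idxBall_of_coordBox {x₀ X : Cell 2 × ℤ} {s k n' : ℝ} (hX : X ∈ idxBall x₀ s) {r : ℕ} (hk : 3 * (r : ℝ) ≤ k) (hs : s + k ≤ n') {p : Cell 2}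
    (hp : ∀ j, |p j - X.1 j| ≤ 3 * (r : ℤ)) : (p, X.2) ∈ idxBall x₀ n' := by
  have hj : ∀ j, ((p - X.1) j).natAbs ≤ 3 * r := fun j => by
    have h := hp j
    rw [Int.abs_eq_natAbs] at h
    show (p j - X.1 j).natAbs ≤ 3 * r
    exact_mod_cast h
  have hu : idxNorm (p - X.1, (0 : ℤ)) ≤ 3 * r := idxNorm_mk_le (hj 0) (hj 1) (by simp)
  have hu' : (idxNorm (p - X.1, (0 : ℤ)) : ℝ) ≤ k := le_trans (by exact_mod_cast hu) hk
  have hX' : X ∈ idxBall x₀ (n' - k) := idxBall_mono x₀ (by linarith) hX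
  have h := add_mem_idxBall hu' hX'
  have e : X + (p - X.1, (0 : ℤ)) = (p, X.2) := Prod.ext (by simp) (by simp)
  rwa [e] at h

/-! ### WF.2  The two energy inputs -/

/-- ★ THE MIXED DIFFERENCES IN MEAN SQUARE: for `ψ` harmonic on `idxBall x₀ n` (`n ≥ 16(ϱ/c + 2)`), an in-plane unit step `E` and `m + 1 ≤ n/2`,
`n²·Σ_{idxBall x₀ m} ‖D₃D_Eψ‖² ≤ 256·(54F/κ₀)·E_n(ψ)` — the vertical difference of the harmonic field `D_Eψ` is a part of its energy (VC), which decays by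
WA `energy_iterate₁_le`. [this file, g58] -/
theorem sum_mixed_sq_le (hc : 0 < c) {κ₀ ϱ : ℝ} (hκ₀ : 0 < κ₀) (hϱ : 0 ≤ ϱ)
    (hP : ∀ E₀ : Cell 2 × ℤ, E₀.2 = 0 → (idxNorm E₀ : ℝ) ≤ 1 → ∀ (y₀ : Cell 2 × ℤ) (r' n' : ℝ), r' < n' → ∀ χ : Cell 2 → ℤ → E3,
      IsTruncHarmonicZ ϱ a b w χ (idxBall y₀ (n' + 1)) →
        κ₀ * idxEnergy (latDiff E₀ χ) (idxBall y₀ r') ≤ 54 * kernelConst c * ((n' - r')⁻¹) ^ 2 * idxEnergy χ (idxBall y₀ (n' + ϱ / c + 1)))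
    (x₀ : Cell 2 × ℤ) {n m : ℝ} (hn : 16 * (ϱ / c + 2) ≤ n) (hm : m + 1 ≤ n / 2) {ψ : Cell 2 → ℤ → E3}
    (hψ : IsTruncHarmonicZ ϱ a b w ψ (idxBall x₀ n)) {E : Cell 2 × ℤ} (hE : E.2 = 0) (hE1 : (idxNorm E : ℝ) ≤ 1) :
    n ^ 2 * ∑ X' ∈ idxBallF x₀ m, ‖latDiff idxAxis₃ (latDiff E ψ) X'.1 X'.2‖ ^ 2 ≤ 256 * (54 * kernelConst c / κ₀) * idxEnergy ψ (idxBall x₀ n) := by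
  have idxNorm_idxAxis₃_le : (idxNorm idxAxis₃ : ℝ) ≤ 1 := by
    have h := dist_add_idxAxis₃_le (0 : Cell 2 × ℤ)
    rwa [dist_eq_idxNorm, zero_add, sub_zero] at h
  have h1 := (sum_norm_latDiff_sq_le x₀ m (latDiff E ψ) idxNorm_idxAxis₃_le).trans (idxEnergy_idxBall_mono (latDiff E ψ) x₀ hm)
  exact (mul_le_mul_of_nonneg_left h1 (sq_nonneg n)).trans (energy_iterate₁_le hc hκ₀ hϱ hP hE hE1 x₀ hn hψ)

/-- ★ THE IN-PLANE SECOND DIFFERENCES POINTWISE (WA `inPlane_hessian_core` solved for the norm): on `idxBall x₀ (n/4)`,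
`‖D_E D_{E'} ψ‖ ≤ √(6912·(54F/κ₀)·lipConst·E_n(ψ)/(n²·#idxBall x₀ n))`. [this file, g58] -/
theorem norm_hessian_le_sqrt (hc : 0 < c) {κ₀ ϱ : ℝ} (hκ₀ : 0 < κ₀) (hϱ : 0 ≤ ϱ)
    (hP : ∀ E₀ : Cell 2 × ℤ, E₀.2 = 0 → (idxNorm E₀ : ℝ) ≤ 1 → ∀ (y₀ : Cell 2 × ℤ) (r' n' : ℝ), r' < n' → ∀ χ : Cell 2 → ℤ → E3,
      IsTruncHarmonicZ ϱ a b w χ (idxBall y₀ (n' + 1)) →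
        κ₀ * idxEnergy (latDiff E₀ χ) (idxBall y₀ r') ≤ 54 * kernelConst c * ((n' - r')⁻¹) ^ 2 * idxEnergy χ (idxBall y₀ (n' + ϱ / c + 1)))
    (x₀ : Cell 2 × ℤ) {n : ℝ} (hn : 32 * (ϱ / c + 2) ≤ n) {ψ : Cell 2 → ℤ → E3} (hψ : IsTruncHarmonicZ ϱ a b w ψ (idxBall x₀ n))
    {E : Cell 2 × ℤ} (hE : E.2 = 0) (hE1 : (idxNorm E : ℝ) ≤ 1) {E' : Cell 2 × ℤ} (hE' : E'.2 = 0) (hE'1 : (idxNorm E' : ℝ) ≤ 1) {X : Cell 2 × ℤ}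
    (hX : X ∈ idxBall x₀ (n / 4)) :
    ‖latDiff E (latDiff E' ψ) X.1 X.2‖ ≤
      Real.sqrt (6912 * (54 * kernelConst c / κ₀) * lipConst c κ₀ * idxEnergy ψ (idxBall x₀ n) / (n ^ 2 * (idxBall x₀ n).ncard)) := by
  have h := inPlane_hessian_core hc hκ₀ hϱ hP hE hE1 hE' hE'1 x₀ hn hψ hX
  have hn0 : 0 < n := by have := div_nonneg hϱ hc.le; linarith
  have hN := ncard_idxBall_pos x₀ hn0.le
  have h2 : ‖latDiff E (latDiff E' ψ) X.1 X.2‖ ^ 2 ≤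
      6912 * (54 * kernelConst c / κ₀) * lipConst c κ₀ * idxEnergy ψ (idxBall x₀ n) / (n ^ 2 * (idxBall x₀ n).ncard) := by
    rw [le_div_iff₀ (by positivity)]
    calc ‖latDiff E (latDiff E' ψ) X.1 X.2‖ ^ 2 * (n ^ 2 * ((idxBall x₀ n).ncard : ℝ))
        = n ^ 2 * ((idxBall x₀ n).ncard : ℝ) * ‖latDiff E (latDiff E' ψ) X.1 X.2‖ ^ 2 := by ring
      _ ≤ _ := h
  have h3 := Real.abs_le_sqrt h2
  rwa [abs_norm] at h3

/-! ### WF.3  ★ The divergence in mean square -/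

/-- the constant of the mean-square divergence bound: `2603778048·F²·(54F/κ₀)·lipConst c κ₀`. [this file, g58] -/
def divConst (c κ₀ : ℝ) : ℝ :=
  2603778048 * kernelConst c ^ 2 * (54 * kernelConst c / κ₀) * lipConst c κ₀

/-- `divConst c κ₀ ≥ 0`. [formal bookkeeping] -/
theorem divConst_nonneg (hc : 0 < c) {κ₀ : ℝ} (hκ₀ : 0 < κ₀) : 0 ≤ divConst c κ₀ := by
  have hF := kernelConst_nonneg hc
  have h1 := one_le_lipConst hc hκ₀
  unfold divConst
  positivity

/-- ★★★ THE COLUMN-FLUX DIVERGENCE OF A HARMONIC FIELD IS SMALL IN MEAN SQUARE: for `ψ` `ϱ`-truncated-harmonic on `idxBall x₀ n` with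
`n ≥ 64(ϱ/c + 2)`, every block `Xs ⊆ idxBall x₀ (n/8)` and every layer set `T` containing the layers of all sites within physical distance `ϱ` of the
block,
`n²·Σ_{X ∈ Xs} ‖colFlux T ψ X.1 X.2 − colFlux T ψ X.1 (X.2 − 1)‖² ≤ divConst c κ₀ · E_n(ψ)` (WE `sum_colFluxDiv_sq_le` with `R = idxBall x₀ (n/8 + ϱ/c)`,
`sum_mixed_sq_le` for the two mixed terms, `norm_hessian_le_sqrt` for `G₂`, and `#Xs ≤ #idxBall x₀ n`). [this file, g58] -/
theorem sum_colFluxDiv_sq_le_energy (hc : 0 < c) (hL : IsLayeredCrystal c a b w) {κ₀ ϱ : ℝ} (hκ₀ : 0 < κ₀) (hϱ : 0 ≤ ϱ)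
    (hP : ∀ E₀ : Cell 2 × ℤ, E₀.2 = 0 → (idxNorm E₀ : ℝ) ≤ 1 → ∀ (y₀ : Cell 2 × ℤ) (r' n' : ℝ), r' < n' → ∀ χ : Cell 2 → ℤ → E3,
      IsTruncHarmonicZ ϱ a b w χ (idxBall y₀ (n' + 1)) →
        κ₀ * idxEnergy (latDiff E₀ χ) (idxBall y₀ r') ≤ 54 * kernelConst c * ((n' - r')⁻¹) ^ 2 * idxEnergy χ (idxBall y₀ (n' + ϱ / c + 1)))
    (x₀ : Cell 2 × ℤ) {n : ℝ} (hn : 64 * (ϱ / c + 2) ≤ n) {ψ : Cell 2 → ℤ → E3} (hψ : IsTruncHarmonicZ ϱ a b w ψ (idxBall x₀ n)) {T : Finset ℤ}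
    {Xs : Finset (Cell 2 × ℤ)} (hXs : ∀ X ∈ Xs, X ∈ idxBall x₀ (n / 8))
    (hS : ∀ X ∈ Xs, ∀ Y : Cell 2 × ℤ, ‖lsite a b w Y.1 Y.2 - lsite a b w X.1 X.2‖ ≤ ϱ → Y.2 ∈ T) :
    n ^ 2 * ∑ X ∈ Xs, ‖colFlux ϱ a b w T ψ X.1 X.2 - colFlux ϱ a b w T ψ X.1 (X.2 - 1)‖ ^ 2 ≤ divConst c κ₀ * idxEnergy ψ (idxBall x₀ n) := by
  have hϱc : 0 ≤ ϱ / c := div_nonneg hϱ hc.le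
  have hn0 : 0 < n := by linarith
  have hF := kernelConst_nonneg hc
  have h1C := one_le_lipConst hc hκ₀
  have hE0 := idxEnergy_nonneg ψ (idxBall x₀ n)
  have hN := ncard_idxBall_pos x₀ hn0.le
  have hr : (⌊ϱ / c⌋₊ : ℝ) ≤ ϱ / c := Nat.floor_le hϱc
  have hKc : 0 ≤ 54 * kernelConst c / κ₀ := by positivity
  -- the hypotheses of WE
  have hT : ∀ X ∈ Xs, X.2 ∈ T := fun X hX => hS X hX X (by rw [sub_self, norm_zero]; exact hϱ)
  have hres : ∀ X ∈ Xs, truncResidual ϱ a b w ψ X = 0 := fun X hX =>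
    truncResidual_eq_zero_of_isTruncHarmonicZ hψ (idxBall_mono x₀ (by linarith) (hXs X hX))
  have hR : ∀ X ∈ Xs, ∀ u : Cell 2 × ℤ, idxNorm u ≤ ⌊ϱ / c⌋₊ → X + u ∈ idxBallF x₀ (n / 8 + ϱ / c) := by
    intro X hX u hu
    have hu' : (idxNorm u : ℝ) ≤ ϱ / c := le_trans (by exact_mod_cast hu) hr
    exact mem_idxBallF.mpr (add_mem_idxBall hu' (by rw [add_sub_cancel_right]; exact hXs X hX))
  have hn32 : 32 * (ϱ / c + 2) ≤ n := by linarith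
  have hn16 : 16 * (ϱ / c + 2) ≤ n := by linarith
  -- an opaque sup `G₂` of the in-plane second differences on `idxBall x₀ (n/4)`
  obtain ⟨G₂, hG0, hGsq, hGb⟩ : ∃ G₂ : ℝ, 0 ≤ G₂ ∧
      n ^ 2 * ((idxBall x₀ n).ncard : ℝ) * (216 * G₂) ^ 2 = 46656 * (6912 * (54 * kernelConst c / κ₀) * lipConst c κ₀ * idxEnergy ψ (idxBall x₀ n)) ∧
      ∀ E : Cell 2 × ℤ, E.2 = 0 → (idxNorm E : ℝ) ≤ 1 → ∀ E' : Cell 2 × ℤ, E'.2 = 0 → (idxNorm E' : ℝ) ≤ 1 → ∀ (p : Cell 2) (β : ℤ),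
        (p, β) ∈ idxBall x₀ (n / 4) → ‖latDiff E (latDiff E' ψ) p β‖ ≤ G₂ := by
    refine ⟨Real.sqrt (6912 * (54 * kernelConst c / κ₀) * lipConst c κ₀ * idxEnergy ψ (idxBall x₀ n) / (n ^ 2 * (idxBall x₀ n).ncard)),
      Real.sqrt_nonneg _, ?_, fun E hE hE1 E' hE' hE'1 p β hX =>
        norm_hessian_le_sqrt hc hκ₀ hϱ hP x₀ hn32 hψ hE hE1 hE' hE'1 (X := (p, β)) hX⟩
    rw [mul_pow, Real.sq_sqrt (by positivity)]
    field_simp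
    ring
  have hG : ∀ X ∈ Xs, ∀ p : Cell 2, (∀ j, |p j - X.1 j| ≤ 3 * (⌊ϱ / c⌋₊ : ℤ)) →
      ‖latDiff idxAxis₁ (latDiff idxAxis₁ ψ) p X.2‖ ≤ G₂ ∧ ‖latDiff idxAxis₂ (latDiff idxAxis₁ ψ) p X.2‖ ≤ G₂ ∧
      ‖latDiff idxAxis₁ (latDiff idxAxis₂ ψ) p X.2‖ ≤ G₂ ∧ ‖latDiff idxAxis₂ (latDiff idxAxis₂ ψ) p X.2‖ ≤ G₂ := by
    intro X hX p hp
    have hpX : (p, X.2) ∈ idxBall x₀ (n / 4) := mem_idxBall_of_coordBox (hXs X hX) (k := 3 * (ϱ / c)) (by linarith) (by linarith) hp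
    exact ⟨hGb idxAxis₁ idxAxis₁_snd idxNorm_idxAxis₁_le idxAxis₁ idxAxis₁_snd idxNorm_idxAxis₁_le p X.2 hpX,
      hGb idxAxis₂ idxAxis₂_snd idxNorm_idxAxis₂_le idxAxis₁ idxAxis₁_snd idxNorm_idxAxis₁_le p X.2 hpX,
      hGb idxAxis₁ idxAxis₁_snd idxNorm_idxAxis₁_le idxAxis₂ idxAxis₂_snd idxNorm_idxAxis₂_le p X.2 hpX,
      hGb idxAxis₂ idxAxis₂_snd idxNorm_idxAxis₂_le idxAxis₂ idxAxis₂_snd idxNorm_idxAxis₂_le p X.2 hpX⟩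
  have hWE := sum_colFluxDiv_sq_le hc hL ψ hT hS hres hR hG0 hG
  -- the energy inputs
  have hm1 : n / 8 + ϱ / c + 1 ≤ n / 2 := by linarith
  have hP₁ := sum_mixed_sq_le hc hκ₀ hϱ hP x₀ hn16 hm1 hψ idxAxis₁_snd idxNorm_idxAxis₁_le
  have hP₂ := sum_mixed_sq_le hc hκ₀ hϱ hP x₀ hn16 hm1 hψ idxAxis₂_snd idxNorm_idxAxis₂_le
  have hXsN : (#Xs : ℝ) ≤ ((idxBall x₀ n).ncard : ℝ) := card_le_ncard_idxBall hXs (by linarith)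
  have hT2 : (#Xs : ℝ) * (n ^ 2 * (216 * G₂) ^ 2) ≤ 46656 * (6912 * (54 * kernelConst c / κ₀) * lipConst c κ₀ * idxEnergy ψ (idxBall x₀ n)) :=
    calc (#Xs : ℝ) * (n ^ 2 * (216 * G₂) ^ 2) ≤ ((idxBall x₀ n).ncard : ℝ) * (n ^ 2 * (216 * G₂) ^ 2) :=
          mul_le_mul_of_nonneg_right hXsN (by positivity)
      _ = n ^ 2 * ((idxBall x₀ n).ncard : ℝ) * (216 * G₂) ^ 2 := by ring
      _ = _ := hGsq
  calc n ^ 2 * ∑ X ∈ Xs, ‖colFlux ϱ a b w T ψ X.1 X.2 - colFlux ϱ a b w T ψ X.1 (X.2 - 1)‖ ^ 2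
      ≤ n ^ 2 * (8 * kernelConst c ^ 2 * (5832 * ((∑ X' ∈ idxBallF x₀ (n / 8 + ϱ / c), ‖latDiff idxAxis₃ (latDiff idxAxis₁ ψ) X'.1 X'.2‖ ^ 2) +
          ∑ X' ∈ idxBallF x₀ (n / 8 + ϱ / c), ‖latDiff idxAxis₃ (latDiff idxAxis₂ ψ) X'.1 X'.2‖ ^ 2) + #Xs * (216 * G₂) ^ 2)) :=
        mul_le_mul_of_nonneg_left hWE (sq_nonneg n)
    _ = 8 * kernelConst c ^ 2 * (5832 * ((n ^ 2 * ∑ X' ∈ idxBallF x₀ (n / 8 + ϱ / c), ‖latDiff idxAxis₃ (latDiff idxAxis₁ ψ) X'.1 X'.2‖ ^ 2) +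
          n ^ 2 * ∑ X' ∈ idxBallF x₀ (n / 8 + ϱ / c), ‖latDiff idxAxis₃ (latDiff idxAxis₂ ψ) X'.1 X'.2‖ ^ 2) + #Xs * (n ^ 2 * (216 * G₂) ^ 2)) := by
        ring
    _ ≤ 8 * kernelConst c ^ 2 * (5832 * (256 * (54 * kernelConst c / κ₀) * idxEnergy ψ (idxBall x₀ n) + 256 * (54 * kernelConst c / κ₀) *
          idxEnergy ψ (idxBall x₀ n)) + 46656 * (6912 * (54 * kernelConst c / κ₀) * lipConst c κ₀ * idxEnergy ψ (idxBall x₀ n))) := by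
        gcongr
    _ = 8 * kernelConst c ^ 2 * (54 * kernelConst c / κ₀) * idxEnergy ψ (idxBall x₀ n) * (2985984 + 322486272 * lipConst c κ₀) := by ring
    _ ≤ 8 * kernelConst c ^ 2 * (54 * kernelConst c / κ₀) * idxEnergy ψ (idxBall x₀ n) * (325472256 * lipConst c κ₀) :=
        mul_le_mul_of_nonneg_left (by linarith) (by positivity)
    _ = divConst c κ₀ * idxEnergy ψ (idxBall x₀ n) := by
        unfold divConst
        ring

/-! ### WF.4  The closed statement of this part -/

/-- The content of part WF as one closed proposition: the mean-square smallness of the column-flux divergence of a truncated-harmonic field on a block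
inside `idxBall x₀ (n/8)`, given the Caccioppoli inequality of the truncated operator (VC `caccioppoli_latDiff` supplies it for `ϱ ≥ ϱ_C` under
coercivity). -/
def DivergenceEnergyShape : Prop :=
  ∀ c : ℝ, 0 < c → ∀ (a b : E3) (w : ℤ → E3), IsLayeredCrystal c a b w → ∀ κ₀ : ℝ, 0 < κ₀ → ∀ ϱ : ℝ, 0 ≤ ϱ →
    (∀ E₀ : Cell 2 × ℤ, E₀.2 = 0 → (idxNorm E₀ : ℝ) ≤ 1 → ∀ (y₀ : Cell 2 × ℤ) (r' n' : ℝ), r' < n' → ∀ χ : Cell 2 → ℤ → E3,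
      IsTruncHarmonicZ ϱ a b w χ (idxBall y₀ (n' + 1)) →
        κ₀ * idxEnergy (latDiff E₀ χ) (idxBall y₀ r') ≤ 54 * kernelConst c * ((n' - r')⁻¹) ^ 2 * idxEnergy χ (idxBall y₀ (n' + ϱ / c + 1))) →
    ∀ (x₀ : Cell 2 × ℤ) (n : ℝ), 64 * (ϱ / c + 2) ≤ n → ∀ ψ : Cell 2 → ℤ → E3, IsTruncHarmonicZ ϱ a b w ψ (idxBall x₀ n) →
      ∀ (T : Finset ℤ) (Xs : Finset (Cell 2 × ℤ)), (∀ X ∈ Xs, X ∈ idxBall x₀ (n / 8)) →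
        (∀ X ∈ Xs, ∀ Y : Cell 2 × ℤ, ‖lsite a b w Y.1 Y.2 - lsite a b w X.1 X.2‖ ≤ ϱ → Y.2 ∈ T) →
          n ^ 2 * ∑ X ∈ Xs, ‖colFlux ϱ a b w T ψ X.1 X.2 - colFlux ϱ a b w T ψ X.1 (X.2 - 1)‖ ^ 2 ≤ divConst c κ₀ * idxEnergy ψ (idxBall x₀ n)

/-- WF holds. [this file, g58] -/
theorem divergenceEnergyShape_holds : DivergenceEnergyShape :=
  fun _c hc _a _b _w hL _κ₀ hκ₀ _ϱ hϱ hP x₀ _n hn _ψ hψ _T _Xs hXs hS => sum_colFluxDiv_sq_le_energy hc hL hκ₀ hϱ hP x₀ hn hψ hXs hS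

end DivergenceEnergy

end Summit.AtomisticToContinuum.Crystallization.Theorems.ChartedZeroExcessLayeredLatticeLiouville
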